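import Mathlib
import Summits.KontsevichZagierPeriods.Zeta5Search.Families.CubicalChartVIM
import Summits.KontsevichZagierPeriods.Zeta5Search.Families.SpanProductHall
import HarnessLib

/-!
# ζ(5) search — the LIVE cone of Brown's `M_{0,10}` family: `leading a b ≠ 0` iff all Hall conditions hold

HONEST FRAMING: systematic search; no irrationality claim unless certified.  Cell `pub-zeta5`, certifier 2 (cert-2 g10,
2026-08-22).  Finite combinatorics of integers; nothing about `ζ(5)` or `ζ(7)`; no number of record moves.

WHAT.  By `Families/CubicalChartVIM`, for every balanced exponent pair `(a, b)` of fam-brown9's generalised "vanishing in the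
middle" family the census leading coefficient `Cells.VanishingMiddleLeading.leading a b` is the gap-coordinate coefficient
`[g^B] vimSpanProd a` — a product of powers of sums of variables.  By the span-product Hall theorem
(`Families/SpanProductHall`, Hall's marriage theorem in Mathlib) such a coefficient is `≥ 1` iff every Hall inequality
`Σ_{e ∈ S} A_e ≤ Σ_{w ∈ N(S)} B_w` holds (`S` a set of the eight finite chords, `N(S)` the gaps they cover), and `0` otherwise.
* `vimSpan`, `vimEdge`, `vimSpanProd_eq_spanProd` — the VIM numerator as a span product;
* `VIMLive a b` — the (decidable) Hall predicate; **`leading_ne_zero_iff_live`**, `one_le_leading_of_live`,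
  `leading_eq_zero_of_not_live`, `leading_nonneg` (balanced pairs);
* **`exists_admissible_void`** — unlike the basic members, the CONVERGENT cone (`Admissible`, Brown's criterion) contains
  balanced integer points with `leading a b = 0` (kernel witness `a = (1,3,0,3,1,2,0,1,3,2)`, `b = (3,1,2,1,2,1,0,4,0,2)`):
  fam-brown9's general-exponent scans (Stage A (b), `STAGE-A-GENERAL.md`) have a non-empty VOID sub-cone to exclude, exactly
  as Brown–Zudilin's family has (`Brown8.liveBZ_iff_QOf_ne_zero`).  Outside the kernel (`HOME/cert-2/g10/code/c4_vim_hall.py`):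
  of 400 random balanced pairs with entries `≤ 3`, 84 are admissible and void, 44 live but not admissible.
Standard axioms only.
-/

noncomputable section

open Finset

namespace Summit.KontsevichZagierPeriods.Zeta5Search.Families.Cellular

namespace CubicalChartN

open Summit.KontsevichZagierPeriods.Zeta5Search.Cells.VanishingMiddleLeading (Balanced Admissible leading
  balanced_basic)

/-- The eight finite chords of the VIM dual cell as gap spans (frame gauge, `6` at infinity), in the order of the exponents
`a 0, a 1, a 2, a 3, a 6, a 7, a 8, a 9`. -/
def vimSpan : Fin 8 → Finset (Fin 8) :=
  ![{6, 7}, {0, 1, 2, 3, 4, 5}, {0, 1, 2, 3, 4, 5, 6}, {2, 3, 4, 5, 6}, {1, 2, 3}, {1, 2}, {3, 4}, {5, 6, 7}]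

/-- The positions in `a` of the eight finite chords. -/
def vimEdge : Fin 8 → Fin 10 := ![0, 1, 2, 3, 6, 7, 8, 9]

/-- **Product form**: `vimSpanProd a = ∏_e (Σ_{w ∈ vimSpan e} X_w)^{a (vimEdge e)}`. -/
theorem vimSpanProd_eq_spanProd (a : Fin 10 → ℕ) :
    vimSpanProd a = SpanHall.spanProd vimSpan (fun e => a (vimEdge e)) := by
  unfold SpanHall.spanProd
  rw [Fin.prod_univ_eight]
  have h0 : SpanHall.spanPoly vimSpan 0 = (MvPolynomial.X 6 + MvPolynomial.X 7 : MvPolynomial (Fin 8) ℤ) := by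
    simp [SpanHall.spanPoly, vimSpan]
  have h1 : SpanHall.spanPoly vimSpan 1 = (MvPolynomial.X 0 + MvPolynomial.X 1 + MvPolynomial.X 2 + MvPolynomial.X 3 + MvPolynomial.X 4 + MvPolynomial.X 5 : MvPolynomial (Fin 8) ℤ) := by
    simp [SpanHall.spanPoly, vimSpan]; ring
  have h2 : SpanHall.spanPoly vimSpan 2 = (MvPolynomial.X 0 + MvPolynomial.X 1 + MvPolynomial.X 2 + MvPolynomial.X 3 + MvPolynomial.X 4 + MvPolynomial.X 5 + MvPolynomial.X 6 : MvPolynomial (Fin 8) ℤ) := by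
    simp [SpanHall.spanPoly, vimSpan]; ring
  have h3 : SpanHall.spanPoly vimSpan 3 = (MvPolynomial.X 2 + MvPolynomial.X 3 + MvPolynomial.X 4 + MvPolynomial.X 5 + MvPolynomial.X 6 : MvPolynomial (Fin 8) ℤ) := by
    simp [SpanHall.spanPoly, vimSpan]; ring
  have h4 : SpanHall.spanPoly vimSpan 4 = (MvPolynomial.X 1 + MvPolynomial.X 2 + MvPolynomial.X 3 : MvPolynomial (Fin 8) ℤ) := by
    simp [SpanHall.spanPoly, vimSpan]; ring
  have h5 : SpanHall.spanPoly vimSpan 5 = (MvPolynomial.X 1 + MvPolynomial.X 2 : MvPolynomial (Fin 8) ℤ) := by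
    simp [SpanHall.spanPoly, vimSpan]
  have h6 : SpanHall.spanPoly vimSpan 6 = (MvPolynomial.X 3 + MvPolynomial.X 4 : MvPolynomial (Fin 8) ℤ) := by
    simp [SpanHall.spanPoly, vimSpan]
  have h7 : SpanHall.spanPoly vimSpan 7 = (MvPolynomial.X 5 + MvPolynomial.X 6 + MvPolynomial.X 7 : MvPolynomial (Fin 8) ℤ) := by
    simp [SpanHall.spanPoly, vimSpan]; ring
  rw [h0, h1, h2, h3, h4, h5, h6, h7]
  simp [vimSpanProd, vimEdge]

/-- **The Hall predicate of the VIM family** (the LIVE cone): for every set `S` of finite chords, the exponents on `S` do not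
exceed the gap exponents on the gaps covered by `S`. -/
def VIMLive (a b : Fin 10 → ℕ) : Prop :=
  ∀ S : Finset (Fin 8), ∑ e ∈ S, a (vimEdge e) ≤ ∑ w ∈ S.biUnion vimSpan, vimGap b w

/-- `VIMLive` is decidable (finitely many linear inequalities). -/
instance (a b : Fin 10 → ℕ) : Decidable (VIMLive a b) := by unfold VIMLive; infer_instance

/-- For a balanced pair the total numerator and gap exponents agree. -/
theorem vim_sum_eq (a b : Fin 10 → ℕ) (hbal : Balanced a b) :
    ∑ e : Fin 8, a (vimEdge e) = ∑ w : Fin 8, vimGap b w := by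
  obtain ⟨v1, v2, v3, v4, v5, v6, v7, v8, v9, v10⟩ := hbal
  rw [Fin.sum_univ_eight, Fin.sum_univ_eight]
  simp only [vimEdge, vimGap, Matrix.cons_val]
  omega

/-- **The census leading coefficient is non-zero iff the pair is live** (balanced pairs). -/
theorem leading_ne_zero_iff_live (a b : Fin 10 → ℕ) (hbal : Balanced a b) : leading a b ≠ 0 ↔ VIMLive a b := by
  rw [leading_eq_vimDualCT a b hbal, vimDualCT, vimSpanProd_eq_spanProd]
  exact SpanHall.coeff_spanProd_ne_zero_iff_hall vimSpan _ _ (vim_sum_eq a b hbal)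

/-- Live ⇒ `leading a b ≥ 1` (a transport table exists). -/
theorem one_le_leading_of_live (a b : Fin 10 → ℕ) (hbal : Balanced a b) (h : VIMLive a b) : 1 ≤ leading a b := by
  rw [leading_eq_vimDualCT a b hbal, vimDualCT, vimSpanProd_eq_spanProd]
  exact SpanHall.one_le_coeff_spanProd_of_hall vimSpan _ _ h (vim_sum_eq a b hbal)

/-- Not live ⇒ `leading a b = 0`. -/
theorem leading_eq_zero_of_not_live (a b : Fin 10 → ℕ) (hbal : Balanced a b) (h : ¬ VIMLive a b) :
    leading a b = 0 := by
  by_contra hne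
  exact h ((leading_ne_zero_iff_live a b hbal).1 hne)

/-- The census leading coefficient of a balanced pair is non-negative (a count). -/
theorem leading_nonneg (a b : Fin 10 → ℕ) (hbal : Balanced a b) : 0 ≤ leading a b := by
  rw [leading_eq_vimDualCT a b hbal, vimDualCT, vimSpanProd_eq_spanProd]
  exact SpanHall.coeff_spanProd_nonneg vimSpan _ _

/-- The Cells.VanishingMiddleLeading.basic members are live: `A n ≥ 1`. -/
theorem one_le_A (n : ℕ) : 1 ≤ CellularVIMRecurrenceLaws.A n := by
  refine one_le_leading_of_live _ _ (balanced_basic n) ?_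
  intro S
  -- every chord covers at least one gap, and distinct chords have distinct spans of size ≥ |S| in total cover
  simp only [Cells.VanishingMiddleLeading.basic, Finset.sum_const, smul_eq_mul]
  have hgap : ∀ w : Fin 8, vimGap (Cells.VanishingMiddleLeading.basic n) w = n := fun w => by fin_cases w <;> rfl
  simp only [hgap, Finset.sum_const, smul_eq_mul]
  refine Nat.mul_le_mul_right n ?_
  -- `|S| ≤ |N(S)|`: the chord `e` covers the gap `rep e`, a system of distinct representatives
  let rep : Fin 8 → Fin 8 := ![7, 0, 6, 4, 1, 2, 3, 5]
  have hrep : ∀ e, rep e ∈ vimSpan e := by decide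
  have hrep_inj : Function.Injective rep := by decide
  calc S.card = (S.image rep).card := (Finset.card_image_of_injective S hrep_inj).symm
    _ ≤ (S.biUnion vimSpan).card := Finset.card_le_card fun w hw => by
        obtain ⟨e, he, rfl⟩ := Finset.mem_image.1 hw
        exact Finset.mem_biUnion.2 ⟨e, he, hrep e⟩

/-- **The convergent cone has a VOID sub-cone**: an admissible (Brown-convergent), balanced exponent pair with
`leading a b = 0` — `a = (1,3,0,3,1,2,0,1,3,2)`, `b = (3,1,2,1,2,1,0,4,0,2)`: the single failing Hall inequality is the
chord `{9,10}` (exponent `a₉ = 3`) against the two gaps `{9,7},{7,10}` it spans (`b₉ + b₁₀ = 0 + 2`). -/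
theorem exists_admissible_void :
    ∃ a b : Fin 10 → ℕ, Admissible a b ∧ Balanced a b ∧ leading a b = 0 :=
  ⟨![1, 3, 0, 3, 1, 2, 0, 1, 3, 2], ![3, 1, 2, 1, 2, 1, 0, 4, 0, 2], by decide, by decide, by decide⟩

end CubicalChartN

end Summit.KontsevichZagierPeriods.Zeta5Search.Families.Cellular
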